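import Literature.Analysis.FluidPDE.ElgindiSolutionExistenceClosure
import Literature.Analysis.FluidPDE.ElgindiRadialLimits
import Literature.Analysis.FluidPDE.ElgindiWordTranspose
import Literature.Analysis.FluidPDE.ElgindiL12Closure
import Literature.Analysis.FluidPDE.ElgindiHkTriangle
import Mathlib.MeasureTheory.Function.LpSpace.Complete
import HarnessLib

/-!
# Elgindi's Theorem 2 at `𝓗⁴` in the closure class
([Elgindi2021] §7.5 Theorem 2 with Remark 8.3: general data)

Topic `Literature/Analysis/FluidPDE`. Support file (definitions with bodies and proved theorems, no
named facts) on the proof path of the named fact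
`Literature.Analysis.FluidPDE.Elgindi.ElgindiGhoulMasmoudi2021_stabilityCore`
(`ElgindiStabilityDecomposition.lean`). T. M. Elgindi, Ann. of Math. 194 (2021) =
arXiv:1904.04795, §7.5 Theorem 2 (p. 24) and §8.1 Remark 8.3 (p. 27).

For `F` in the `𝓗⁴`-closure of the test functions (`HkApprox α F f`), the Theorem 2 solutions
`Ψ_n` of `L_αΨ_n = f_n` converge (along a fast subsequence, `ElgindiSolutionExistenceClosure.lean`) to a
smooth solution `Ψ` of `L_αΨ = F`, the corrector data `L₁₂(f_n)` converge in `C⁴_loc(0,∞)` to `Λ`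
(`ElgindiRadialLimits.lean`), and the weighted words of the three controlled quantities
`∂_θθΨ_n + α⁻¹L₁₂(f_n) ⊗ sin 2θ` (`= ∂_θθ(Ψ_n − (4α)⁻¹L₁₂(f_n) sin 2θ)`), `α²D_R²Ψ_n`, `α²D_RΨ_n` are
Cauchy in `L²(strip)` by Theorem 2 for differences; their `L²`-limits are identified distributionally
(`ElgindiWordTranspose.lean`) with the words of the limit quantities. Hence (`theoremTwo_closure`)
`|∂_θθΨ + α⁻¹Λ ⊗ sin 2θ|²_{𝓗⁴} + |α²D_R²Ψ|²_{𝓗⁴} + |α²D_RΨ|²_{𝓗⁴} ≤ C·|F|²_{𝓗⁴}` with the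
same constant `C = thmTwoC` as for test data (`|f_n|²_{𝓗⁴} → |F|²_{𝓗⁴}`, `ElgindiHkTriangle.lean`),
and `Λ = L₁₂(F)` on `[0,∞)` (`ElgindiL12Closure.lean`): `theoremTwo_closure_L12`,
`theoremTwo_of_finite_L12`.
-/

noncomputable section

open MeasureTheory Set Function Real Filter
open _root_.Topology
open scoped ENNReal ContDiff

namespace Literature.Analysis.FluidPDE

namespace Elgindi

/-! ### `L²(strip)` norms and the functional `eL2Sq` -/

/-- `∫∫_strip ‖f‖² = ‖f‖²_{L²(strip)}`. [folklore] -/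
private theorem lintegral_enorm_sq_eq_eLpNorm_sq (f : ℝ × ℝ → ℝ) :
    ∫⁻ p in strip, ‖f p‖ₑ ^ 2 = (eLpNorm f 2 (volume.restrict strip)) ^ 2 := by
  rw [eLpNorm_eq_lintegral_rpow_enorm_toReal two_ne_zero ENNReal.ofNat_ne_top]
  simp only [ENNReal.toReal_ofNat, one_div]
  rw [← ENNReal.rpow_natCast ((∫⁻ x, ‖f x‖ₑ ^ (2:ℝ) ∂volume.restrict strip) ^ (2:ℝ)⁻¹) 2, ← ENNReal.rpow_mul]
  norm_num

/-- `eL2Sq g = ‖g‖²_{L²(strip)}`. [folklore] -/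
theorem eL2Sq_eq_eLpNorm_sq (g : ℝ → ℝ → ℝ) :
    eL2Sq g = (eLpNorm (fun p : ℝ × ℝ => g p.1 p.2) 2 (volume.restrict strip)) ^ 2 := by
  rw [← lintegral_enorm_sq_eq_eLpNorm_sq]; rfl

/-- **Hölder on the strip**: `∫∫_strip ‖fg‖ ≤ ‖f‖_{L²}‖g‖_{L²}`. [folklore] -/
private theorem lintegral_enorm_mul_le_eLpNorm {f g : ℝ × ℝ → ℝ} (hf : AEStronglyMeasurable f (volume.restrict strip))
    (hg : AEStronglyMeasurable g (volume.restrict strip)) :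
    ∫⁻ p in strip, ‖f p * g p‖ₑ ≤ eLpNorm f 2 (volume.restrict strip) * eLpNorm g 2 (volume.restrict strip) := by
  have h := ENNReal.lintegral_mul_le_Lp_mul_Lq (volume.restrict strip) Real.HolderConjugate.two_two
    hf.aemeasurable.enorm hg.aemeasurable.enorm
  rw [eLpNorm_eq_lintegral_rpow_enorm_toReal two_ne_zero ENNReal.ofNat_ne_top, eLpNorm_eq_lintegral_rpow_enorm_toReal two_ne_zero ENNReal.ofNat_ne_top]
  simp only [ENNReal.toReal_ofNat]
  refine le_trans (le_of_eq (lintegral_congr fun p => ?_)) h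
  rw [Pi.mul_apply, enorm_mul]

/-! ### Identification of `L²` limits against test functions -/

/-- An `L²(strip)` function is locally integrable on the strip. [folklore] -/
private theorem locallyIntegrableOn_of_memLp_two {u : ℝ × ℝ → ℝ} (hu : MemLp u 2 (volume.restrict strip)) : LocallyIntegrableOn u strip volume := by
  refine (locallyIntegrableOn_iff isOpen_strip.isLocallyClosed).2 fun K hKs hK => ?_
  have hle : (volume.restrict K : Measure (ℝ × ℝ)) ≤ volume.restrict strip := Measure.restrict_mono hKs le_rfl
  haveI : IsFiniteMeasure (volume.restrict K) := isFiniteMeasure_restrict.2 hK.measure_lt_top.ne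
  exact (hu.mono_measure hle).integrable one_le_two

/-- Pairings with test functions pass to `L²(strip)` limits. [folklore] -/
theorem tendsto_integral_mul_test_of_L2 {h : ℕ → ℝ × ℝ → ℝ} {Hl : ℝ × ℝ → ℝ}
    (hmeas : ∀ n, AEStronglyMeasurable (h n) (volume.restrict strip)) (hHlm : AEStronglyMeasurable Hl (volume.restrict strip))
    (hmem : ∀ n, MemLp (h n) 2 (volume.restrict strip)) (hHlmem : MemLp Hl 2 (volume.restrict strip))
    (hL2 : Tendsto (fun n => eLpNorm (h n - Hl) 2 (volume.restrict strip)) atTop (𝓝 0))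
    {φ : ℝ → ℝ → ℝ} (hφ : StripTest φ) :
    Tendsto (fun n => ∫ p in strip, h n p * φ p.1 p.2) atTop (𝓝 (∫ p in strip, Hl p * φ p.1 p.2)) := by
  have hφm : MemLp (fun p : ℝ × ℝ => φ p.1 p.2) 2 (volume.restrict strip) := by
    have := memLp_strip_of_continuous (f := fun p : ℝ × ℝ => φ p.1 p.2) (hφ.smooth 0).continuous hφ.supp
    unfold stripMeasure at this; exact this
  have hφa : AEStronglyMeasurable (fun p : ℝ × ℝ => φ p.1 p.2) (volume.restrict strip) := hφm.1
  have hint : ∀ {v : ℝ × ℝ → ℝ}, MemLp v 2 (volume.restrict strip) → Integrable (fun p => v p * φ p.1 p.2) (volume.restrict strip) :=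
    fun hv => memLp_one_iff_integrable.1 (MemLp.mul' (f := fun p : ℝ × ℝ => φ p.1 p.2) hφm hv)
  refine tendsto_integral_of_L1 (fun p => Hl p * φ p.1 p.2) (hint hHlmem).1 (Eventually.of_forall fun n => hint (hmem n)) ?_
  -- `∫ ‖h_nφ − H φ‖ ≤ ‖h_n − H‖_{L²}‖φ‖_{L²} → 0`
  have hb : ∀ n, ∫⁻ p in strip, ‖h n p * φ p.1 p.2 - Hl p * φ p.1 p.2‖ₑ ≤
      eLpNorm (h n - Hl) 2 (volume.restrict strip) * eLpNorm (fun p : ℝ × ℝ => φ p.1 p.2) 2 (volume.restrict strip) := by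
    intro n
    refine le_trans (le_of_eq (lintegral_congr fun p => ?_)) (lintegral_enorm_mul_le_eLpNorm ((hmeas n).sub hHlm) hφa)
    rw [Pi.sub_apply, sub_mul]
  have h0 : Tendsto (fun n => eLpNorm (h n - Hl) 2 (volume.restrict strip) * eLpNorm (fun p : ℝ × ℝ => φ p.1 p.2) 2 (volume.restrict strip))
      atTop (𝓝 0) := by
    have := ENNReal.Tendsto.mul_const hL2 (Or.inr hφm.2.ne)
    rwa [zero_mul] at this
  exact tendsto_of_tendsto_of_tendsto_of_le_of_le tendsto_const_nhds h0 (fun n => bot_le) hb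

/-- **Identification of `L²` limits of a Cauchy sequence with summable rates**: if `h_n` is Cauchy
in `L²(strip)` with summable rates and `∫∫ h_nφ → ∫∫ Hφ` for all test functions of the strip, `H`
continuous on the strip, then `‖h_n‖²_{L²(strip)} → ‖H‖²_{L²(strip)}`. [folklore] -/
theorem tendsto_lintegral_sq_of_cauchy_of_test {h : ℕ → ℝ × ℝ → ℝ} {H : ℝ × ℝ → ℝ}
    (hmeas : ∀ n, AEStronglyMeasurable (h n) (volume.restrict strip))
    (hfin : ∀ n, eLpNorm (h n) 2 (volume.restrict strip) < ⊤)
    {B : ℕ → ℝ≥0∞} (hB : ∑' i, B i ≠ ⊤) (hcau : ∀ N n m : ℕ, N ≤ n → N ≤ m → eLpNorm (h n - h m) 2 (volume.restrict strip) < B N)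
    (hH : ContinuousOn H strip)
    (htest : ∀ φ : ℝ → ℝ → ℝ, StripTest φ → Tendsto (fun n => ∫ p in strip, h n p * φ p.1 p.2) atTop (𝓝 (∫ p in strip, H p * φ p.1 p.2))) :
    Tendsto (fun n => ∫⁻ p in strip, ‖h n p‖ₑ ^ 2) atTop (𝓝 (∫⁻ p in strip, ‖H p‖ₑ ^ 2)) := by
  -- the `L²` limit
  have hae : ∀ᵐ p ∂(volume.restrict strip), ∃ l : ℝ, Tendsto (fun n => h n p) atTop (𝓝 l) :=
    Lp.ae_tendsto_of_cauchy_eLpNorm hmeas one_le_two hB hcau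
  set Hl : ℝ × ℝ → ℝ := fun p => limUnder atTop (fun n => h n p) with hHl
  have hlim : ∀ᵐ p ∂(volume.restrict strip), Tendsto (fun n => h n p) atTop (𝓝 (Hl p)) := hae.mono fun p hp => tendsto_nhds_limUnder hp
  have hL2 : Tendsto (fun n => eLpNorm (h n - Hl) 2 (volume.restrict strip)) atTop (𝓝 0) := Lp.cauchy_tendsto_of_tendsto hmeas Hl hB hcau hlim
  have hHlm : AEStronglyMeasurable Hl (volume.restrict strip) := aestronglyMeasurable_of_tendsto_ae atTop hmeas hlim
  have hmem : ∀ n, MemLp (h n) 2 (volume.restrict strip) := fun n => ⟨hmeas n, hfin n⟩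
  have hHlmem : MemLp Hl 2 (volume.restrict strip) := Lp.memLp_of_cauchy_tendsto one_le_two hmem Hl hHlm hL2
  -- `Hl = H` a.e. on the strip
  have hpair : ∀ φ : ℝ → ℝ → ℝ, StripTest φ →
      Tendsto (fun n => ∫ p in strip, h n p * φ p.1 p.2) atTop (𝓝 (∫ p in strip, Hl p * φ p.1 p.2)) :=
    fun φ hφ => tendsto_integral_mul_test_of_L2 hmeas hHlm hmem hHlmem hL2 hφ
  have haeq : ∀ᵐ y ∂(volume : Measure (ℝ × ℝ)), y ∈ strip → Hl y = H y :=
    ae_eq_on_strip_of_test (locallyIntegrableOn_of_memLp_two hHlmem) hH fun φ hφn hφs hφS =>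
      tendsto_nhds_unique (hpair φ ⟨hφn, hφs, hφS⟩) (htest φ ⟨hφn, hφs, hφS⟩)
  have haeq' : ∀ᵐ y ∂(volume.restrict strip), Hl y = H y := (ae_restrict_iff' measurableSet_strip).2 haeq
  have eH : ∫⁻ p in strip, ‖H p‖ₑ ^ 2 = ∫⁻ p in strip, ‖Hl p‖ₑ ^ 2 :=
    lintegral_congr_ae (haeq'.mono fun p hp => by show ‖H p‖ₑ ^ 2 = ‖Hl p‖ₑ ^ 2; rw [hp])
  rw [eH, lintegral_enorm_sq_eq_eLpNorm_sq]
  simp_rw [lintegral_enorm_sq_eq_eLpNorm_sq]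
  -- `‖h_n‖ → ‖Hl‖`
  have hε := hL2
  have hnorm : Tendsto (fun n => eLpNorm (h n) 2 (volume.restrict strip)) atTop (𝓝 (eLpNorm Hl 2 (volume.restrict strip))) := by
    have h1 : ∀ n, eLpNorm Hl 2 (volume.restrict strip) ≤ eLpNorm (h n) 2 (volume.restrict strip) + eLpNorm (h n - Hl) 2 (volume.restrict strip) := by
      intro n
      have e : Hl = h n + (Hl - h n) := by funext p; simp
      calc eLpNorm Hl 2 (volume.restrict strip) = eLpNorm (h n + (Hl - h n)) 2 (volume.restrict strip) := by rw [← e]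
        _ ≤ eLpNorm (h n) 2 (volume.restrict strip) + eLpNorm (Hl - h n) 2 (volume.restrict strip) :=
            eLpNorm_add_le (hmeas n) (hHlm.sub (hmeas n)) one_le_two
        _ = _ := by rw [eLpNorm_sub_comm]
    have h2 : ∀ n, eLpNorm (h n) 2 (volume.restrict strip) ≤ eLpNorm Hl 2 (volume.restrict strip) + eLpNorm (h n - Hl) 2 (volume.restrict strip) := by
      intro n
      have e : h n = Hl + (h n - Hl) := by funext p; simp
      calc eLpNorm (h n) 2 (volume.restrict strip) = eLpNorm (Hl + (h n - Hl)) 2 (volume.restrict strip) := by rw [← e]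
        _ ≤ _ := eLpNorm_add_le hHlm ((hmeas n).sub hHlm) one_le_two
    have hlow : Tendsto (fun n => eLpNorm Hl 2 (volume.restrict strip) - eLpNorm (h n - Hl) 2 (volume.restrict strip)) atTop
        (𝓝 (eLpNorm Hl 2 (volume.restrict strip))) := by
      have := ENNReal.Tendsto.sub (tendsto_const_nhds (x := eLpNorm Hl 2 (volume.restrict strip))) hε (Or.inl hHlmem.2.ne)
      rwa [tsub_zero] at this
    have hup : Tendsto (fun n => eLpNorm Hl 2 (volume.restrict strip) + eLpNorm (h n - Hl) 2 (volume.restrict strip)) atTop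
        (𝓝 (eLpNorm Hl 2 (volume.restrict strip))) := by
      have := (tendsto_const_nhds (x := eLpNorm Hl 2 (volume.restrict strip))).add hε
      rwa [add_zero] at this
    exact tendsto_of_tendsto_of_tendsto_of_le_of_le hlow hup (fun n => tsub_le_iff_right.2 (h1 n)) h2
  exact ((ENNReal.continuous_pow 2).tendsto _).comp hnorm

/-! ### Smooth weights, tensors and `∂_θ`-identities on the strip -/

/-- The radial weight is smooth on `(0,∞)`. [folklore] -/
theorem contDiffOn_radialWeight_Ioi {n : WithTop ℕ∞} : ContDiffOn ℝ n radialWeight (Ioi 0) := by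
  have e : radialWeight = fun z : ℝ => (1 + z) ^ 2 / z ^ 2 := rfl
  rw [e]
  exact ContDiffOn.div (by fun_prop) (by fun_prop) fun z hz => pow_ne_zero 2 (ne_of_gt hz)

/-- The word weights are smooth on the open strip. [folklore] -/
theorem contDiffOn_wordWeight_strip (α : ℝ) (i : ℕ) : ContDiffOn ℝ ∞ (fun p : ℝ × ℝ => wordWeight α i p.1 p.2) strip := by
  have hsinpos : ∀ p ∈ strip, 0 < Real.sin (2 * p.2) := fun p hp =>
    Real.sin_pos_of_pos_of_lt_pi (by linarith [hp.2.1]) (by linarith [hp.2.2])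
  have hr : ContDiffOn ℝ ∞ (fun p : ℝ × ℝ => radialWeight p.1) strip :=
    contDiffOn_radialWeight_Ioi.comp contDiffOn_fst fun p hp => hp.1
  have hs : ∀ r : ℝ, ContDiffOn ℝ ∞ (fun p : ℝ × ℝ => Real.sin (2 * p.2) ^ r) strip := fun r =>
    ContDiffOn.rpow_const_of_ne (by fun_prop) fun p hp => (hsinpos p hp).ne'
  by_cases hi : i = 0
  · simp only [wordWeight, hi, if_true, hWeight]
    exact hr.div (hs _) fun p hp => (Real.rpow_pos_of_pos (hsinpos p hp) _).ne'
  · simp only [wordWeight, hi, if_false, totalWeight, thetaWeight]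
    exact hr.mul (hs _)

/-- Tensors of functions smooth on `(0,∞)` and on `ℝ` are smooth on the strip. [folklore] -/
theorem contDiffOn_tensor_strip {Λf s : ℝ → ℝ} {n : WithTop ℕ∞} (hΛ : ContDiffOn ℝ n Λf (Ioi 0)) (hs : ContDiff ℝ n s) :
    ContDiffOn ℝ n (uncurry (tensor Λf s)) strip := by
  have e : uncurry (tensor Λf s) = fun p : ℝ × ℝ => Λf p.1 * s p.2 := by funext p; rfl
  rw [e]
  exact (hΛ.comp contDiffOn_fst fun p hp => hp.1).mul (hs.comp_contDiffOn contDiffOn_snd)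

/-- `∂_θ(w − cΛ(R)s(θ)) = ∂_θw − cΛ(R)s′(θ)` on the strip. [folklore] -/
theorem dθ_sub_corr_strip {w : ℝ → ℝ → ℝ} (hw : ContDiffOn ℝ ∞ (uncurry w) strip) (Λf : ℝ → ℝ) (c : ℝ) {s : ℝ → ℝ}
    (hs : Differentiable ℝ s) {p : ℝ × ℝ} (hp : p ∈ strip) :
    dθ (fun R θ => w R θ - c * Λf R * s θ) p.1 p.2 = dθ w p.1 p.2 - c * Λf p.1 * deriv s p.2 :=
  ((TangentialFamily.hasDerivAt_slice_strip hw hp).sub (((hs p.2).hasDerivAt).const_mul (c * Λf p.1))).deriv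

/-- **`∂_θθ(u − cΛ sin 2θ) = ∂_θθu + 4cΛ sin 2θ` on the strip.** [folklore] -/
theorem dθ_dθ_corr_strip {u : ℝ → ℝ → ℝ} (hu : ContDiffOn ℝ ∞ (uncurry u) strip) (Λf : ℝ → ℝ) (c : ℝ) {p : ℝ × ℝ} (hp : p ∈ strip) :
    dθ (dθ fun R θ => u R θ - c * Λf R * Real.sin (2 * θ)) p.1 p.2 = dθ (dθ u) p.1 p.2 + 4 * c * Λf p.1 * Real.sin (2 * p.2) := by
  have hsin : Differentiable ℝ fun θ : ℝ => Real.sin (2 * θ) := by fun_prop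
  have hcos : Differentiable ℝ fun θ : ℝ => 2 * Real.cos (2 * θ) := by fun_prop
  have hd1 : ∀ θ : ℝ, deriv (fun θ : ℝ => Real.sin (2 * θ)) θ = 2 * Real.cos (2 * θ) := fun θ => by
    have h : HasDerivAt (fun θ : ℝ => Real.sin (2 * θ)) (Real.cos (2 * θ) * (2 * 1)) θ :=
      (Real.hasDerivAt_sin (2 * θ)).comp θ ((hasDerivAt_id θ).const_mul 2)
    rw [h.deriv]; ring
  have hd2 : ∀ θ : ℝ, deriv (fun θ : ℝ => 2 * Real.cos (2 * θ)) θ = -4 * Real.sin (2 * θ) := fun θ => by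
    have h : HasDerivAt (fun θ : ℝ => 2 * Real.cos (2 * θ)) (2 * (-Real.sin (2 * θ) * (2 * 1))) θ :=
      ((Real.hasDerivAt_cos (2 * θ)).comp θ ((hasDerivAt_id θ).const_mul 2)).const_mul 2
    rw [h.deriv]; ring
  have s1 : ∀ q ∈ strip, dθ (fun R θ => u R θ - c * Λf R * Real.sin (2 * θ)) q.1 q.2 =
      dθ u q.1 q.2 - c * Λf q.1 * (2 * Real.cos (2 * q.2)) := by
    intro q hq
    rw [dθ_sub_corr_strip hu Λf c hsin hq, hd1]
  rw [dθ_congr (g := fun R θ => dθ u R θ - c * Λf R * (2 * Real.cos (2 * θ))) s1 hp,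
    dθ_sub_corr_strip (contDiffOn_dθ_strip hu) Λf c hcos hp, hd2]
  ring

/-- `∂_θ(u − v) = ∂_θu − ∂_θv` on the strip. [folklore] -/
theorem dθ_sub_of_strip {u v : ℝ → ℝ → ℝ} (hu : ContDiffOn ℝ ∞ (uncurry u) strip) (hv : ContDiffOn ℝ ∞ (uncurry v) strip)
    {p : ℝ × ℝ} (hp : p ∈ strip) : dθ (u - v) p.1 p.2 = dθ u p.1 p.2 - dθ v p.1 p.2 :=
  ((TangentialFamily.hasDerivAt_slice_strip hu hp).sub (TangentialFamily.hasDerivAt_slice_strip hv hp)).deriv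

/-- `∂_θθ(u − v) = ∂_θθu − ∂_θθv` on the strip. [folklore] -/
theorem dθ_dθ_sub_of_strip {u v : ℝ → ℝ → ℝ} (hu : ContDiffOn ℝ ∞ (uncurry u) strip) (hv : ContDiffOn ℝ ∞ (uncurry v) strip)
    {p : ℝ × ℝ} (hp : p ∈ strip) : dθ (dθ (u - v)) p.1 p.2 = dθ (dθ u) p.1 p.2 - dθ (dθ v) p.1 p.2 := by
  have s1 : ∀ q ∈ strip, dθ (u - v) q.1 q.2 = (dθ u - dθ v) q.1 q.2 := fun q hq => dθ_sub_of_strip hu hv hq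
  rw [dθ_congr s1 hp]
  exact dθ_sub_of_strip (contDiffOn_dθ_strip hu) (contDiffOn_dθ_strip hv) hp

/-! ### The controlled quantity of order `∂_θθ` -/

/-- The `∂_θθ`-quantity of Theorem 2 in "plus form": `∂_θθΦ + α⁻¹Λ ⊗ sin 2θ`
(`= ∂_θθ(Φ − (4α)⁻¹Λ sin 2θ)` on the strip, `eHkNormSq_corrQ_eq`). [cite: Elgindi2021, §7.5 Theorem 2 (p. 24 of arXiv:1904.04795)] -/
def corrQ (α : ℝ) (Φ : ℝ → ℝ → ℝ) (Λf : ℝ → ℝ) : ℝ → ℝ → ℝ := dθ (dθ Φ) + α⁻¹ • tensor Λf sin2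

/-- `|∂_θθ(u − (4α)⁻¹Λ sin 2θ)|²_{𝓗⁴} = |corrQ α u Λ|²_{𝓗⁴}` for `u` smooth on the strip. [folklore] -/
theorem eHkNormSq_corrQ_eq {α : ℝ} (hα : α ≠ 0) {u : ℝ → ℝ → ℝ} (hu : ContDiffOn ℝ ∞ (uncurry u) strip) (Λf : ℝ → ℝ) :
    eHkNormSq α 4 (dθ (dθ fun R θ => u R θ - 1 / (4 * α) * Λf R * Real.sin (2 * θ))) = eHkNormSq α 4 (corrQ α u Λf) :=
  eHkNormSq_congr_strip α 4 fun p hp => by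
    rw [dθ_dθ_corr_strip hu Λf _ hp]
    simp only [corrQ, Pi.add_apply, Pi.smul_apply, smul_eq_mul, tensor_apply, sin2]
    field_simp

/-- `corrQ` is smooth on the strip when `Φ` is and `Λ ∈ Cⁿ(0,∞)` (`n + 2`-version not needed). [folklore] -/
theorem contDiffOn_corrQ {α : ℝ} {Φ : ℝ → ℝ → ℝ} {Λf : ℝ → ℝ} {n : ℕ} (hΦ : ContDiffOn ℝ ∞ (uncurry Φ) strip)
    (hΛ : ContDiffOn ℝ n Λf (Ioi 0)) : ContDiffOn ℝ n (uncurry (corrQ α Φ Λf)) strip := by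
  have h1 : ContDiffOn ℝ n (uncurry (dθ (dθ Φ))) strip :=
    (contDiffOn_dθ_strip (contDiffOn_dθ_strip hΦ)).of_le (WithTop.coe_le_coe.2 le_top : (n : WithTop ℕ∞) ≤ ((⊤ : ℕ∞) : WithTop ℕ∞))
  have h2 : ContDiffOn ℝ n (uncurry (tensor Λf sin2)) strip := contDiffOn_tensor_strip hΛ (by unfold sin2; fun_prop)
  exact (h1.add (h2.const_smul α⁻¹)).congr fun _ _ => rfl

/-! ### The limit data -/

/-- **The data of the passage to the limit in Theorem 2** along a fast `𝓗⁴`-approximating sequence: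
the approximating test data `f_n`, solution data of the modified problems, the smooth limit solution
`Ψ` of `L_αΨ = F` with `L¹_loc` convergence of the Theorem 2 solutions, and the `C⁴_loc` limit
`Λ = G 0` of the corrector data `L₁₂(f_n)`. [folklore] -/
structure ThmTwoLimit (α : ℝ) (F : ℝ → ℝ → ℝ) (fs : ℕ → ℝ → ℝ → ℝ) (U : ℕ → ℕ → E4) (Ψr : ℕ → ℝ × ℝ → ℝ)
    (Ψ : ℝ × ℝ → ℝ) (G : ℕ → ℝ → ℝ) : Prop where
  approx : HkApprox α F fs
  sol : ∀ n, SolData α (Fhat (fs n)) (U n) (Ψr n)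
  fast : ∀ n, eHkNormSq α 4 (fs n - F) ≤ ((2:ℝ≥0∞)⁻¹ ^ n) ^ 2
  smooth : ContDiffOn ℝ ∞ Ψ strip
  eqn : ∀ p ∈ strip, ellipticOp α (fun R θ => Ψ (R, θ)) p.1 p.2 = F p.1 p.2
  convΨ : ∀ K ⊆ strip, IsCompact K → Tendsto (fun n => ∫ p in K, |thmTwoSol α (fs n) (Ψr n) p.1 p.2 - Ψ p|) atTop (𝓝 0)
  unifG : TendstoUniformly (fun n => L12 (fs n)) (G 0) atTop
  locG : ∀ j ≤ 4, TendstoLocallyUniformlyOn (fun n => Dz₁^[j] (L12 (fs n))) (G j) atTop (Ioi 0)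
  contG : ∀ j ≤ 4, ContinuousOn (G j) (Ioi 0)
  smoothG : ContDiffOn ℝ 4 (G 0) (Ioi 0)
  keyG : ∀ j ≤ 4, ∀ x ∈ Ioi 0, (Dz₁^[j] (G 0)) x = G j x

/-- **Existence of the limit data** along a fast approximating sequence. [folklore] -/
theorem exists_thmTwoLimit {α : ℝ} {F : ℝ → ℝ → ℝ} {fs : ℕ → ℝ → ℝ → ℝ} (hA : HkApprox α F fs)
    {U : ℕ → ℕ → E4} {Ψr : ℕ → ℝ × ℝ → ℝ} (hS : ∀ n, SolData α (Fhat (fs n)) (U n) (Ψr n))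
    (hfast : ∀ n, eHkNormSq α 4 (fs n - F) ≤ ((2:ℝ≥0∞)⁻¹ ^ n) ^ 2) :
    ∃ (Ψ : ℝ × ℝ → ℝ) (G : ℕ → ℝ → ℝ), ThmTwoLimit α F fs U Ψr Ψ G := by
  obtain ⟨Ψ, hΨs, hΨeq, -, hL1⟩ := exists_solution_of_fast hA hS hfast
  obtain ⟨G, hTU, hTLU, hcontG, -, c0, key⟩ := hA.exists_corrector_limit
  have hα : 0 < α := (hS 0).pos
  have hα4 : α ≤ 1 / 4 := (hS 0).le4
  have hN : ∀ n, NiceDatum (fs n) := fun n => (hA.test n).niceDatum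
  have hT := fun n => theoremTwo_solData hα hα4 (hN n) (hS n)
  have hΨm : AEStronglyMeasurable Ψ (volume.restrict strip) := hΨs.continuousOn.aestronglyMeasurable measurableSet_strip
  have hv : ∀ n, AEStronglyMeasurable (fun p : ℝ × ℝ => thmTwoSol α (fs n) (Ψr n) p.1 p.2 - Ψ p) (volume.restrict strip) :=
    fun n => ((hT n).1.continuousOn.aestronglyMeasurable measurableSet_strip).sub hΨm
  exact ⟨Ψ, G, ⟨hA, hS, hfast, hΨs, hΨeq, fun K hKs hK => tendsto_setIntegral_abs_of_weighted hv hL1 hK hKs, hTU, hTLU, hcontG, c0, key⟩⟩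

namespace ThmTwoLimit

variable {α : ℝ} {F : ℝ → ℝ → ℝ} {fs : ℕ → ℝ → ℝ → ℝ} {U : ℕ → ℕ → E4} {Ψr : ℕ → ℝ × ℝ → ℝ}
  {Ψ : ℝ × ℝ → ℝ} {G : ℕ → ℝ → ℝ} (D : ThmTwoLimit α F fs U Ψr Ψ G)
include D

/-- `0 < α`. [folklore] -/
theorem pos : 0 < α := (D.sol 0).pos

/-- `α ≤ 1/4`. [folklore] -/
theorem le4 : α ≤ 1 / 4 := (D.sol 0).le4

/-- The approximating data are nice data. [folklore] -/
theorem nice (n : ℕ) : NiceDatum (fs n) := (D.approx.test n).niceDatum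

/-- The Theorem 2 solutions are smooth on the strip and solve `LΨ_n = f_n`. [folklore] -/
theorem solSmooth (n : ℕ) : ContDiffOn ℝ ∞ (uncurry (thmTwoSol α (fs n) (Ψr n))) strip :=
  (theoremTwo_solData D.pos D.le4 (D.nice n) (D.sol n)).1

/-- `Ψ` as a curried function is smooth on the strip. [folklore] -/
theorem limSmooth : ContDiffOn ℝ ∞ (uncurry fun R θ => Ψ (R, θ)) strip := D.smooth.congr fun _ _ => rfl

/-- The corrector data are smooth. [folklore] -/
theorem contDiff_L12 (n : ℕ) : ContDiff ℝ ∞ (L12 (fs n)) := (D.nice n).contDiff_L12F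

/-- **Theorem 2 for each `n` (plus form)**:
`|corrQ(Ψ_n, L₁₂f_n)|² + |α²D_R²Ψ_n|² + |α²D_RΨ_n|² ≤ C|f_n|²`. [cite: Elgindi2021, §7.5 Theorem 2 (p. 24 of arXiv:1904.04795)] -/
theorem bound (n : ℕ) :
    eHkNormSq α 4 (corrQ α (thmTwoSol α (fs n) (Ψr n)) (L12 (fs n))) + eHkNormSq α 4 ((α ^ 2) • (Dz^[2] (thmTwoSol α (fs n) (Ψr n)))) +
      eHkNormSq α 4 ((α ^ 2) • Dz (thmTwoSol α (fs n) (Ψr n))) ≤ thmTwoC * eHkNormSq α 4 (fs n) := by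
  have h := (theoremTwo_solData D.pos D.le4 (D.nice n) (D.sol n)).2.2
  rwa [eHkNormSq_corrQ_eq D.pos.ne' (D.solSmooth n)] at h

/-- **Theorem 2 for differences (plus form)**. [cite: Elgindi2021, §7.5 Theorem 2 (p. 24 of arXiv:1904.04795)] -/
theorem sub_bound (n m : ℕ) :
    eHkNormSq α 4 (corrQ α (thmTwoSol α (fs n) (Ψr n)) (L12 (fs n)) - corrQ α (thmTwoSol α (fs m) (Ψr m)) (L12 (fs m))) +
      eHkNormSq α 4 ((α ^ 2) • (Dz^[2] (thmTwoSol α (fs n) (Ψr n))) - (α ^ 2) • (Dz^[2] (thmTwoSol α (fs m) (Ψr m)))) +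
      eHkNormSq α 4 ((α ^ 2) • Dz (thmTwoSol α (fs n) (Ψr n)) - (α ^ 2) • Dz (thmTwoSol α (fs m) (Ψr m))) ≤
      thmTwoC * eHkNormSq α 4 (fs n - fs m) := by
  have h := (theoremTwo_sub D.pos D.le4 (D.nice n) (D.nice m) (D.sol n) (D.sol m)).2
  set A := thmTwoSol α (fs n) (Ψr n) with hA
  set B := thmTwoSol α (fs m) (Ψr m) with hB
  have hAs : ContDiffOn ℝ ∞ (uncurry A) strip := D.solSmooth n
  have hBs : ContDiffOn ℝ ∞ (uncurry B) strip := D.solSmooth m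
  have hABs : ContDiffOn ℝ ∞ (uncurry (A - B)) strip := (hAs.sub hBs).congr fun _ _ => rfl
  have h4 : ∀ {u : ℝ → ℝ → ℝ}, ContDiffOn ℝ ∞ (uncurry u) strip → ContDiffOn ℝ 4 (uncurry u) strip :=
    fun hu => hu.of_le (WithTop.coe_le_coe.2 le_top : (4 : WithTop ℕ∞) ≤ ((⊤ : ℕ∞) : WithTop ℕ∞))
  -- the three identifications on the strip
  have e1 : eHkNormSq α 4 (dθ (dθ fun R θ => (A - B) R θ - 1 / (4 * α) * L12 (fs n - fs m) R * Real.sin (2 * θ))) =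
      eHkNormSq α 4 (corrQ α A (L12 (fs n)) - corrQ α B (L12 (fs m))) := by
    rw [eHkNormSq_corrQ_eq D.pos.ne' hABs]
    refine eHkNormSq_congr_strip α 4 fun p hp => ?_
    simp only [corrQ, Pi.add_apply, Pi.sub_apply, Pi.smul_apply, smul_eq_mul, tensor_apply, (D.nice n).L12_sub (D.nice m) p.1,
      dθ_dθ_sub_of_strip hAs hBs hp]
    ring
  have e2 : eHkNormSq α 4 ((α ^ 2) • (Dz^[2] (A - B))) = eHkNormSq α 4 ((α ^ 2) • (Dz^[2] A) - (α ^ 2) • (Dz^[2] B)) := by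
    refine eHkNormSq_congr_strip α 4 fun p hp => ?_
    have e := iterate_Dθ_Dz_sub (h4 hAs) (h4 hBs) (i := 0) (j := 2) (by norm_num) p hp
    simp only [Function.iterate_zero, id_eq] at e
    simp only [Pi.smul_apply, Pi.sub_apply, smul_eq_mul]
    rw [e, mul_sub]
  have e3 : eHkNormSq α 4 ((α ^ 2) • Dz (A - B)) = eHkNormSq α 4 ((α ^ 2) • Dz A - (α ^ 2) • Dz B) := by
    refine eHkNormSq_congr_strip α 4 fun p hp => ?_
    have e := iterate_Dθ_Dz_sub (h4 hAs) (h4 hBs) (i := 0) (j := 1) (by norm_num) p hp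
    simp only [Function.iterate_zero, Function.iterate_one, id_eq] at e
    simp only [Pi.smul_apply, Pi.sub_apply, smul_eq_mul]
    rw [e, mul_sub]
  rw [e1, e2, e3] at h
  exact h

/-- The fast rate: `|f_n − f_m|²_{𝓗⁴} ≤ (2·2^{−N})²` for `n, m ≥ N`. [folklore] -/
theorem fast_sub {N n m : ℕ} (hn : N ≤ n) (hm : N ≤ m) : eHkNormSq α 4 (fs n - fs m) ≤ (2 * (2:ℝ≥0∞)⁻¹ ^ N) ^ 2 := by
  have hF4 : ContDiffOn ℝ 4 (uncurry F) strip :=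
    D.approx.smooth.of_le (WithTop.coe_le_coe.2 le_top : (4 : WithTop ℕ∞) ≤ ((⊤ : ℕ∞) : WithTop ℕ∞))
  have hr1 : ∀ {k : ℕ}, N ≤ k → (2:ℝ≥0∞)⁻¹ ^ k ≤ (2:ℝ≥0∞)⁻¹ ^ N := fun h =>
    pow_le_pow_right_of_le_one' (ENNReal.inv_le_one.2 one_le_two) h
  refine (eHkNormSq_sub_le_two ((D.nice n).smooth 4).contDiffOn ((D.nice m).smooth 4).contDiffOn hF4).trans ?_
  calc 2 * eHkNormSq α 4 (fs n - F) + 2 * eHkNormSq α 4 (fs m - F)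
      ≤ 2 * ((2:ℝ≥0∞)⁻¹ ^ n) ^ 2 + 2 * ((2:ℝ≥0∞)⁻¹ ^ m) ^ 2 := by
        gcongr
        · exact D.fast n
        · exact D.fast m
    _ ≤ 2 * ((2:ℝ≥0∞)⁻¹ ^ N) ^ 2 + 2 * ((2:ℝ≥0∞)⁻¹ ^ N) ^ 2 := by
        gcongr 2 * ?_ ^ 2 + 2 * ?_ ^ 2
        · exact hr1 hn
        · exact hr1 hm
    _ = (2 * (2:ℝ≥0∞)⁻¹ ^ N) ^ 2 := by ring

end ThmTwoLimit

/-! ### Convergence of one weighted word -/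

/-- `a ≤ b` from `a² ≤ b²` in `ℝ≥0∞`. [folklore] -/
private theorem ennreal_le_of_sq_le_sq {a b : ℝ≥0∞} (h : a ^ 2 ≤ b ^ 2) : a ≤ b := by
  have h' := ENNReal.rpow_le_rpow h (by norm_num : (0:ℝ) ≤ 1 / 2)
  rwa [← ENNReal.rpow_natCast a 2, ← ENNReal.rpow_natCast b 2, ← ENNReal.rpow_mul, ← ENNReal.rpow_mul,
    show ((2:ℕ):ℝ) * (1 / 2) = 1 by norm_num, ENNReal.rpow_one, ENNReal.rpow_one] at h'

/-- **Convergence of the `L²`-norm of one weighted word** along a sequence of strip-smooth functions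
`v_n` with fast `𝓗⁴`-Cauchy rates, given the distributional convergence of that weighted word. [folklore] -/
theorem tendsto_eL2Sq_word {α : ℝ} {v : ℕ → ℝ → ℝ → ℝ} {V : ℝ → ℝ → ℝ} (hv : ∀ n, ContDiffOn ℝ ∞ (uncurry (v n)) strip)
    (hV : ContDiffOn ℝ 4 (uncurry V) strip) {C : ℝ≥0∞} (hC : C ≠ ⊤)
    (hbd : ∀ N n m : ℕ, N ≤ n → N ≤ m → eHkNormSq α 4 (v n - v m) ≤ C * (2 * (2:ℝ≥0∞)⁻¹ ^ N) ^ 2)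
    (hfinv : ∀ n, eHkNormSq α 4 (v n) < ⊤) {i j : ℕ} (hij : i + j ≤ 4)
    (htest : ∀ φ : ℝ → ℝ → ℝ, StripTest φ →
      Tendsto (fun n => ∫ p in strip, (Dθ^[i] (Dz^[j] (v n))) p.1 p.2 * wordWeight α i p.1 p.2 * φ p.1 p.2) atTop
        (𝓝 (∫ p in strip, (Dθ^[i] (Dz^[j] V)) p.1 p.2 * wordWeight α i p.1 p.2 * φ p.1 p.2))) :
    Tendsto (fun n => eL2Sq (fun z θ => (Dθ^[i] (Dz^[j] (v n))) z θ * wordWeight α i z θ)) atTop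
      (𝓝 (eL2Sq (fun z θ => (Dθ^[i] (Dz^[j] V)) z θ * wordWeight α i z θ))) := by
  set h : ℕ → ℝ × ℝ → ℝ := fun n p => (Dθ^[i] (Dz^[j] (v n))) p.1 p.2 * wordWeight α i p.1 p.2 with hh
  set H : ℝ × ℝ → ℝ := fun p => (Dθ^[i] (Dz^[j] V)) p.1 p.2 * wordWeight α i p.1 p.2 with hH
  have hv4 : ∀ n, ContDiffOn ℝ 4 (uncurry (v n)) strip := fun n =>
    (hv n).of_le (WithTop.coe_le_coe.2 le_top : (4 : WithTop ℕ∞) ≤ ((⊤ : ℕ∞) : WithTop ℕ∞))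
  have hcont : ∀ n, ContinuousOn (h n) strip := fun n =>
    (continuousOn_iterate_Dθ_Dz (hv4 n) hij).mul (continuousOn_wordWeight α i)
  have hmeas : ∀ n, AEStronglyMeasurable (h n) (volume.restrict strip) := fun n => (hcont n).aestronglyMeasurable measurableSet_strip
  have hHc : ContinuousOn H strip := (continuousOn_iterate_Dθ_Dz hV hij).mul (continuousOn_wordWeight α i)
  -- squares of `L²` norms are the `eL2Sq` of the weighted words
  have esq : ∀ n, (eLpNorm (h n) 2 (volume.restrict strip)) ^ 2 = eL2Sq (fun z θ => (Dθ^[i] (Dz^[j] (v n))) z θ * wordWeight α i z θ) :=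
    fun n => by rw [eL2Sq_eq_eLpNorm_sq]
  have esub : ∀ n m, (eLpNorm (h n - h m) 2 (volume.restrict strip)) ^ 2 ≤ eHkNormSq α 4 (v n - v m) := by
    intro n m
    rw [← lintegral_enorm_sq_eq_eLpNorm_sq]
    have e : ∫⁻ p in strip, ‖(h n - h m) p‖ₑ ^ 2 = eL2Sq (fun z θ => (Dθ^[i] (Dz^[j] (v n - v m))) z θ * wordWeight α i z θ) := by
      unfold eL2Sq
      refine setLIntegral_congr_fun measurableSet_strip fun p hp => ?_
      simp only [hh, Pi.sub_apply]
      rw [iterate_Dθ_Dz_sub (hv4 n) (hv4 m) hij p hp, sub_mul]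
    rw [e]
    exact eL2Sq_weighted_word_le α hij _
  have hfin : ∀ n, eLpNorm (h n) 2 (volume.restrict strip) < ⊤ := by
    intro n
    have hsq : (eLpNorm (h n) 2 (volume.restrict strip)) ^ 2 < ⊤ := by
      rw [esq n]; exact lt_of_le_of_lt (eL2Sq_weighted_word_le α hij (v n)) (hfinv n)
    refine lt_top_iff_ne_top.2 fun htop => ?_
    rw [htop, pow_two, ENNReal.top_mul_top] at hsq
    exact absurd hsq (lt_irrefl _)
  -- the summable Cauchy rates
  set B : ℕ → ℝ≥0∞ := fun N => (C ^ (1 / 2 : ℝ) + 1) * (2 * (2:ℝ≥0∞)⁻¹ ^ N) with hB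
  have hBsum : ∑' N, B N ≠ ⊤ := by
    simp only [hB]
    rw [ENNReal.tsum_mul_left, ENNReal.tsum_mul_left, ENNReal.tsum_geometric, ENNReal.one_sub_inv_two, inv_inv]
    exact ENNReal.mul_ne_top (ENNReal.add_ne_top.2 ⟨ENNReal.rpow_ne_top_of_nonneg (by norm_num) hC, ENNReal.one_ne_top⟩)
      (ENNReal.mul_ne_top ENNReal.ofNat_ne_top ENNReal.ofNat_ne_top)
  have hcau : ∀ N n m : ℕ, N ≤ n → N ≤ m → eLpNorm (h n - h m) 2 (volume.restrict strip) < B N := by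
    intro N n m hn hm
    have h1 : (eLpNorm (h n - h m) 2 (volume.restrict strip)) ^ 2 ≤ (C ^ (1 / 2 : ℝ) * (2 * (2:ℝ≥0∞)⁻¹ ^ N)) ^ 2 := by
      refine ((esub n m).trans (hbd N n m hn hm)).trans_eq ?_
      have hCsq : (C ^ (1 / 2 : ℝ)) ^ 2 = C := by
        rw [← ENNReal.rpow_natCast (C ^ (1 / 2 : ℝ)) 2, ← ENNReal.rpow_mul, show (1 / 2 : ℝ) * ((2:ℕ):ℝ) = 1 by norm_num,
          ENNReal.rpow_one]
      conv_rhs => rw [mul_pow, hCsq]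
    refine (ennreal_le_of_sq_le_sq h1).trans_lt ?_
    refine ENNReal.mul_lt_mul_left ?_ ?_ (ENNReal.lt_add_right (ENNReal.rpow_ne_top_of_nonneg (by norm_num) hC) one_ne_zero)
    · exact mul_ne_zero two_ne_zero (pow_ne_zero _ (ENNReal.inv_ne_zero.2 ENNReal.ofNat_ne_top))
    · exact ENNReal.mul_ne_top ENNReal.ofNat_ne_top (ENNReal.pow_ne_top (ENNReal.inv_ne_top.2 two_ne_zero))
  have htest' : ∀ φ : ℝ → ℝ → ℝ, StripTest φ → Tendsto (fun n => ∫ p in strip, h n p * φ p.1 p.2) atTop (𝓝 (∫ p in strip, H p * φ p.1 p.2)) :=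
    fun φ hφ => htest φ hφ
  have key := tendsto_lintegral_sq_of_cauchy_of_test hmeas hfin hBsum hcau hHc htest'
  exact key

/-- **Convergence of the `𝓗⁴` functional** along such a sequence, given the distributional
convergence of all weighted words of order `≤ 4`. [folklore] -/
theorem tendsto_eHkNormSq_of_words {α : ℝ} {v : ℕ → ℝ → ℝ → ℝ} {V : ℝ → ℝ → ℝ} (hv : ∀ n, ContDiffOn ℝ ∞ (uncurry (v n)) strip)
    (hV : ContDiffOn ℝ 4 (uncurry V) strip) {C : ℝ≥0∞} (hC : C ≠ ⊤)
    (hbd : ∀ N n m : ℕ, N ≤ n → N ≤ m → eHkNormSq α 4 (v n - v m) ≤ C * (2 * (2:ℝ≥0∞)⁻¹ ^ N) ^ 2)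
    (hfinv : ∀ n, eHkNormSq α 4 (v n) < ⊤)
    (htest : ∀ i j : ℕ, i + j ≤ 4 → ∀ φ : ℝ → ℝ → ℝ, StripTest φ →
      Tendsto (fun n => ∫ p in strip, (Dθ^[i] (Dz^[j] (v n))) p.1 p.2 * wordWeight α i p.1 p.2 * φ p.1 p.2) atTop
        (𝓝 (∫ p in strip, (Dθ^[i] (Dz^[j] V)) p.1 p.2 * wordWeight α i p.1 p.2 * φ p.1 p.2))) :
    Tendsto (fun n => eHkNormSq α 4 (v n)) atTop (𝓝 (eHkNormSq α 4 V)) := by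
  have hrad : ∀ (g : ℝ → ℝ → ℝ) (j : ℕ), eL2Sq (hkRadialTerm j g) = eL2Sq (fun z θ => (Dθ^[0] (Dz^[j] g)) z θ * wordWeight α 0 z θ) := by
    intro g j; congr 1
  have hmix : ∀ (g : ℝ → ℝ → ℝ) (i j : ℕ), 1 ≤ i → eL2Sq (hkMixedTerm α i j g) = eL2Sq (fun z θ => (Dθ^[i] (Dz^[j] g)) z θ * wordWeight α i z θ) := by
    intro g i j hi
    have hi0 : i ≠ 0 := by omega
    congr 1; funext z θ; simp [hkMixedTerm, wordWeight, hi0]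
  unfold eHkNormSq
  refine Tendsto.add (tendsto_finsetSum _ fun j hj => ?_) (tendsto_finsetSum _ fun i hi => tendsto_finsetSum _ fun j hj => ?_)
  · have hj4 : 0 + j ≤ 4 := by have := Finset.mem_range.1 hj; omega
    simp_rw [hrad]
    exact tendsto_eL2Sq_word hv hV hC hbd hfinv hj4 (htest 0 j hj4)
  · split_ifs with hc
    · simp_rw [hmix _ i j hc.1]
      exact tendsto_eL2Sq_word hv hV hC hbd hfinv hc.2 (htest i j hc.2)
    · exact tendsto_const_nhds

/-! ### The words of the controlled quantities -/

/-- The `D_θ₁`-iterates of `sin 2θ` are smooth. [folklore] -/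
theorem contDiff_iterate_Dθ₁_sin2 (i : ℕ) : ContDiff ℝ ∞ (Dθ₁^[i] sin2) := by
  obtain ⟨P, hP, e⟩ := iterate_Dθ₁_sin2 i
  rw [e]
  exact (by fun_prop : ContDiff ℝ ∞ fun θ : ℝ => Real.sin (2 * θ)).mul hP

/-- Words of `α²D_R^m Φ`: `D_θ^iD_R^j(α²D_R^mΦ) = α²D_θ^iD_R^{j+m}Φ` (globally). [folklore] -/
theorem word_smul_iterate_Dz (c : ℝ) (Φ : ℝ → ℝ → ℝ) (i j m : ℕ) (z θ : ℝ) :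
    (Dθ^[i] (Dz^[j] (c • (Dz^[m] Φ)))) z θ = c * (Dθ^[i] (Dz^[j + m] Φ)) z θ := by
  rw [iterate_Dz_smul, iterate_Dθ_smul, Pi.smul_apply, Pi.smul_apply, smul_eq_mul, Function.iterate_add_apply]

/-- **Words of `corrQ` on the strip**: `D_θ^iD_R^j(∂_θθΦ + α⁻¹Λ ⊗ sin 2θ) = D_θ^iD_R^j∂_θθΦ + α⁻¹(D_R^jΛ)(R)·(D_θ₁^i sin 2θ)(θ)`
for `Φ` smooth on the strip and `Λ ∈ C⁴(0,∞)`, `i + j ≤ 4`. [folklore] -/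
theorem word_corrQ_strip {α : ℝ} {Φ : ℝ → ℝ → ℝ} {Λf : ℝ → ℝ} (hΦ : ContDiffOn ℝ ∞ (uncurry Φ) strip)
    (hΛ : ContDiffOn ℝ 4 Λf (Ioi 0)) {i j : ℕ} (hij : i + j ≤ 4) {p : ℝ × ℝ} (hp : p ∈ strip) :
    (Dθ^[i] (Dz^[j] (corrQ α Φ Λf))) p.1 p.2 =
      (Dθ^[i] (Dz^[j] (dθ (dθ Φ)))) p.1 p.2 + α⁻¹ * (Dz₁^[j] Λf) p.1 * (Dθ₁^[i] sin2) p.2 := by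
  have h1 : ContDiffOn ℝ 4 (uncurry (dθ (dθ Φ))) strip :=
    (contDiffOn_dθ_strip (contDiffOn_dθ_strip hΦ)).of_le (WithTop.coe_le_coe.2 le_top : (4 : WithTop ℕ∞) ≤ ((⊤ : ℕ∞) : WithTop ℕ∞))
  have h2 : ContDiffOn ℝ 4 (uncurry (α⁻¹ • tensor Λf sin2)) strip :=
    ((contDiffOn_tensor_strip hΛ (by unfold sin2; fun_prop)).const_smul α⁻¹).congr fun _ _ => rfl
  unfold corrQ
  rw [iterate_Dθ_Dz_add h1 h2 hij p hp, iterate_Dz_smul, iterate_Dθ_smul, iterate_Dθ_Dz_tensor]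
  simp only [Pi.smul_apply, smul_eq_mul, tensor_apply]
  ring

namespace ThmTwoLimit

variable {α : ℝ} {F : ℝ → ℝ → ℝ} {fs : ℕ → ℝ → ℝ → ℝ} {U : ℕ → ℕ → E4} {Ψr : ℕ → ℝ × ℝ → ℝ}
  {Ψ : ℝ × ℝ → ℝ} {G : ℕ → ℝ → ℝ} (D : ThmTwoLimit α F fs U Ψr Ψ G)
include D

/-! ### Distributional convergence of the words -/

/-- **The `Ψ`-part**: `∫∫ (D_θ^iD_R^j∂_θ^aΨ_n)ψ → ∫∫ (D_θ^iD_R^j∂_θ^aΨ)ψ` for test functions `ψ`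
(transposition, `L¹_loc` convergence of `Ψ_n`, transposition back). [folklore] -/
theorem tendsto_word_sol {ψ : ℝ → ℝ → ℝ} (hψ : StripTest ψ) (i j a : ℕ) :
    Tendsto (fun n => ∫ p in strip, (Dθ^[i] (Dz^[j] (dθ^[a] (thmTwoSol α (fs n) (Ψr n))))) p.1 p.2 * ψ p.1 p.2) atTop
      (𝓝 (∫ p in strip, (Dθ^[i] (Dz^[j] (dθ^[a] fun R θ => Ψ (R, θ)))) p.1 p.2 * ψ p.1 p.2)) := by
  have hT := hψ.wordT i j a
  simp_rw [integral_word_mul_test (D.solSmooth _) hψ i j a]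
  rw [integral_word_mul_test D.limSmooth hψ i j a]
  have hl : ∀ {v : ℝ × ℝ → ℝ}, ContDiffOn ℝ ∞ v strip → LocallyIntegrableOn v strip volume :=
    fun hv => hv.continuousOn.locallyIntegrableOn measurableSet_strip
  have h := tendsto_integral_mul_of_L1loc (us := fun n (p : ℝ × ℝ) => thmTwoSol α (fs n) (Ψr n) p.1 p.2) (u := Ψ)
    (g := fun p : ℝ × ℝ => (dθT^[a] (DzT^[j] (DθT^[i] ψ))) p.1 p.2) (hT.smooth 0).continuous hT.supp hT.sub
    (fun n => hl (D.solSmooth n)) (hl D.smooth) D.convΨ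
  exact h

/-- **The corrector part**: `∫∫ (D_R^jL₁₂f_n)(R)·b → ∫∫ (G j)(R)·b` for `b = ψ ⊗-like` test data
(dominated convergence under locally uniform convergence on `(0,∞)`). [folklore] -/
theorem tendsto_corrector_pairing {ψ : ℝ → ℝ → ℝ} (hψ : StripTest ψ) {i j : ℕ} (hj : j ≤ 4) :
    Tendsto (fun n => ∫ p in strip, (Dz₁^[j] (L12 (fs n))) p.1 * (ψ p.1 p.2 * (Dθ₁^[i] sin2) p.2)) atTop
      (𝓝 (∫ p in strip, G j p.1 * (ψ p.1 p.2 * (Dθ₁^[i] sin2) p.2))) := by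
  set K := tsupport (uncurry ψ) with hK
  have hKc : IsCompact K := hψ.supp
  have hKs : K ⊆ strip := hψ.sub
  set K₁ : Set ℝ := Prod.fst '' K with hK₁
  have hK₁c : IsCompact K₁ := hKc.image continuous_fst
  have hK₁s : K₁ ⊆ Ioi 0 := by rintro x ⟨p, hp, rfl⟩; exact (hKs hp).1
  have hU : TendstoUniformlyOn (fun n => Dz₁^[j] (L12 (fs n))) (G j) atTop K₁ :=
    (tendstoLocallyUniformlyOn_iff_forall_isCompact isOpen_Ioi).1 (D.locG j hj) K₁ hK₁s hK₁c
  obtain ⟨M, hM⟩ := hK₁c.exists_bound_of_continuousOn ((D.contG j hj).mono hK₁s)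
  -- the test datum `b`
  set b : ℝ × ℝ → ℝ := fun p => ψ p.1 p.2 * (Dθ₁^[i] sin2) p.2 with hb
  have hbT : StripTest fun z θ => ψ z θ * (Dθ₁^[i] sin2) θ :=
    hψ.mulOn (φ := fun p : ℝ × ℝ => (Dθ₁^[i] sin2) p.2) (((contDiff_iterate_Dθ₁_sin2 i).comp contDiff_snd).contDiffOn)
  have hbi : Integrable b (volume.restrict strip) := hbT.integrable.integrableOn
  have hb0 : ∀ p, p ∉ K → b p = 0 := fun p hp => by
    simp only [hb]; rw [show ψ p.1 p.2 = uncurry ψ p from rfl, image_eq_zero_of_notMem_tsupport hp, zero_mul]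
  have hbc : Continuous b := ((hψ.smooth 0).continuous).mul ((contDiff_iterate_Dθ₁_sin2 i).continuous.comp continuous_snd)
  refine tendsto_integral_filter_of_dominated_convergence (fun p => (M + 1) * |b p|) ?_ ?_ (hbi.abs.const_mul _) ?_
  · refine Eventually.of_forall fun n => ?_
    have ha : Continuous (Dz₁^[j] (L12 (fs n))) := (contDiff_iterate_Dz₁_infty (D.contDiff_L12 n) j).continuous
    exact ((ha.comp continuous_fst).mul hbc).aestronglyMeasurable
  · have hev : ∀ᶠ n in atTop, ∀ x ∈ K₁, dist (G j x) ((Dz₁^[j] (L12 (fs n))) x) < 1 :=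
      (Metric.tendstoUniformlyOn_iff.1 hU) 1 one_pos
    filter_upwards [hev] with n hn
    refine ae_of_all _ fun p => ?_
    by_cases hp : p ∈ K
    · have hx : p.1 ∈ K₁ := ⟨p, hp, rfl⟩
      have h1 : |(Dz₁^[j] (L12 (fs n))) p.1| ≤ M + 1 := by
        have hd := hn p.1 hx
        rw [Real.dist_eq] at hd
        have hMx := hM p.1 hx
        rw [Real.norm_eq_abs] at hMx
        have := abs_sub_abs_le_abs_sub ((Dz₁^[j] (L12 (fs n))) p.1) (G j p.1)
        rw [abs_sub_comm] at this
        linarith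
      rw [Real.norm_eq_abs, abs_mul]
      exact mul_le_mul_of_nonneg_right h1 (abs_nonneg _)
    · have h0 : ψ p.1 p.2 = 0 := by have := image_eq_zero_of_notMem_tsupport hp; exact this
      simp only [h0, zero_mul, mul_zero, norm_zero]
      rw [hb0 p hp, abs_zero, mul_zero]
  · refine ae_of_all _ fun p => ?_
    by_cases hp : p ∈ K
    · exact ((D.locG j hj).tendsto_at (hKs hp).1).mul_const _
    · have h0 : ψ p.1 p.2 = 0 := by have := image_eq_zero_of_notMem_tsupport hp; exact this
      simp [h0]

omit D in
/-- The test function `φ·(weight)` of a word pairing. [folklore] -/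
theorem stripTest_mul_wordWeight {φ : ℝ → ℝ → ℝ} (hφ : StripTest φ) (i : ℕ) : StripTest fun R θ => φ R θ * wordWeight α i R θ :=
  hφ.mulOn (φ := fun p : ℝ × ℝ => wordWeight α i p.1 p.2) (contDiffOn_wordWeight_strip α i)

/-- **Distributional convergence of the words of `α²D_R^mΨ_n`** (`m = 1, 2`). [folklore] -/
theorem htest_smul_Dz (m : ℕ) {i j : ℕ} (_hij : i + j ≤ 4) {φ : ℝ → ℝ → ℝ} (hφ : StripTest φ) :
    Tendsto (fun n => ∫ p in strip, (Dθ^[i] (Dz^[j] ((α ^ 2) • (Dz^[m] (thmTwoSol α (fs n) (Ψr n)))))) p.1 p.2 * wordWeight α i p.1 p.2 * φ p.1 p.2)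
      atTop (𝓝 (∫ p in strip, (Dθ^[i] (Dz^[j] ((α ^ 2) • (Dz^[m] fun R θ => Ψ (R, θ))))) p.1 p.2 * wordWeight α i p.1 p.2 * φ p.1 p.2)) := by
  have hψ : StripTest fun R θ => φ R θ * wordWeight α i R θ := stripTest_mul_wordWeight hφ i
  have e : ∀ (Φ : ℝ → ℝ → ℝ), (fun p : ℝ × ℝ => (Dθ^[i] (Dz^[j] ((α ^ 2) • (Dz^[m] Φ)))) p.1 p.2 * wordWeight α i p.1 p.2 * φ p.1 p.2) =
      fun p => α ^ 2 * ((Dθ^[i] (Dz^[j + m] (dθ^[0] Φ))) p.1 p.2 * (φ p.1 p.2 * wordWeight α i p.1 p.2)) := by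
    intro Φ; funext p
    rw [word_smul_iterate_Dz, Function.iterate_zero, id_eq]; ring
  simp_rw [e, MeasureTheory.integral_const_mul]
  exact (D.tendsto_word_sol hψ i (j + m) 0).const_mul _

/-- **Distributional convergence of the words of `corrQ(Ψ_n, L₁₂f_n)`.** [folklore] -/
theorem htest_corrQ {i j : ℕ} (hij : i + j ≤ 4) {φ : ℝ → ℝ → ℝ} (hφ : StripTest φ) :
    Tendsto (fun n => ∫ p in strip, (Dθ^[i] (Dz^[j] (corrQ α (thmTwoSol α (fs n) (Ψr n)) (L12 (fs n))))) p.1 p.2 * wordWeight α i p.1 p.2 * φ p.1 p.2)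
      atTop (𝓝 (∫ p in strip, (Dθ^[i] (Dz^[j] (corrQ α (fun R θ => Ψ (R, θ)) (G 0)))) p.1 p.2 * wordWeight α i p.1 p.2 * φ p.1 p.2)) := by
  have hψ : StripTest fun R θ => φ R θ * wordWeight α i R θ := stripTest_mul_wordWeight hφ i
  have hj : j ≤ 4 := by omega
  have hΛn : ∀ n, ContDiffOn ℝ 4 (L12 (fs n)) (Ioi 0) := fun n =>
    ((D.contDiff_L12 n).of_le (WithTop.coe_le_coe.2 le_top : (4 : WithTop ℕ∞) ≤ ((⊤ : ℕ∞) : WithTop ℕ∞))).contDiffOn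
  -- decomposition of the integrands on the strip
  have en : ∀ n, ∫ p in strip, (Dθ^[i] (Dz^[j] (corrQ α (thmTwoSol α (fs n) (Ψr n)) (L12 (fs n))))) p.1 p.2 * wordWeight α i p.1 p.2 * φ p.1 p.2 =
      (∫ p in strip, (Dθ^[i] (Dz^[j] (dθ^[2] (thmTwoSol α (fs n) (Ψr n))))) p.1 p.2 * (φ p.1 p.2 * wordWeight α i p.1 p.2)) +
        α⁻¹ * ∫ p in strip, (Dz₁^[j] (L12 (fs n))) p.1 * ((φ p.1 p.2 * wordWeight α i p.1 p.2) * (Dθ₁^[i] sin2) p.2) := by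
    intro n
    have h1 : StripTest fun z θ => (φ z θ * wordWeight α i z θ) * uncurry (Dθ^[i] (Dz^[j] (dθ^[2] (thmTwoSol α (fs n) (Ψr n))))) (z, θ) :=
      hψ.mulOn (contDiffOn_iterate_Dθ_strip_infty (contDiffOn_iterate_Dz_strip_infty (contDiffOn_iterate_dθ_strip (D.solSmooth n) 2) j) i)
    have h2 : StripTest fun z θ => (φ z θ * wordWeight α i z θ) * ((Dz₁^[j] (L12 (fs n))) (z, θ).1 * (Dθ₁^[i] sin2) (z, θ).2) :=
      hψ.mulOn (φ := fun p : ℝ × ℝ => (Dz₁^[j] (L12 (fs n))) p.1 * (Dθ₁^[i] sin2) p.2)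
        ((((contDiff_iterate_Dz₁_infty (D.contDiff_L12 n) j).comp contDiff_fst).mul ((contDiff_iterate_Dθ₁_sin2 i).comp contDiff_snd)).contDiffOn)
    rw [← MeasureTheory.integral_const_mul, ← integral_add]
    · refine setIntegral_congr_fun measurableSet_strip fun p hp => ?_
      rw [word_corrQ_strip (D.solSmooth n) (hΛn n) hij hp]
      simp only [Function.iterate_succ, Function.iterate_zero, Function.comp_apply, id_eq]
      ring
    · have := h1.integrable.integrableOn (s := strip)
      refine this.congr (ae_of_all _ fun p => ?_)
      simp only [uncurry_apply_pair]; ring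
    · have := (h2.integrable.const_mul α⁻¹).integrableOn (s := strip)
      refine this.congr (ae_of_all _ fun p => ?_)
      simp only; ring
  have eL : ∫ p in strip, (Dθ^[i] (Dz^[j] (corrQ α (fun R θ => Ψ (R, θ)) (G 0)))) p.1 p.2 * wordWeight α i p.1 p.2 * φ p.1 p.2 =
      (∫ p in strip, (Dθ^[i] (Dz^[j] (dθ^[2] fun R θ => Ψ (R, θ)))) p.1 p.2 * (φ p.1 p.2 * wordWeight α i p.1 p.2)) +
        α⁻¹ * ∫ p in strip, G j p.1 * ((φ p.1 p.2 * wordWeight α i p.1 p.2) * (Dθ₁^[i] sin2) p.2) := by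
    have h1 : StripTest fun z θ => (φ z θ * wordWeight α i z θ) * uncurry (Dθ^[i] (Dz^[j] (dθ^[2] fun R θ => Ψ (R, θ)))) (z, θ) :=
      hψ.mulOn (contDiffOn_iterate_Dθ_strip_infty (contDiffOn_iterate_Dz_strip_infty (contDiffOn_iterate_dθ_strip D.limSmooth 2) j) i)
    -- integrability of the corrector part (continuous on the strip, supported in `tsupport ψ`)
    set K := tsupport (uncurry fun z θ => φ z θ * wordWeight α i z θ) with hK
    have hKc : IsCompact K := hψ.supp
    have hKs : K ⊆ strip := hψ.sub
    have hcorr : IntegrableOn (fun p : ℝ × ℝ => α⁻¹ * (G j p.1 * ((φ p.1 p.2 * wordWeight α i p.1 p.2) * (Dθ₁^[i] sin2) p.2))) strip volume := by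
      have hc : ContinuousOn (fun p : ℝ × ℝ => α⁻¹ * (G j p.1 * ((φ p.1 p.2 * wordWeight α i p.1 p.2) * (Dθ₁^[i] sin2) p.2))) strip := by
        refine continuousOn_const.mul ((((D.contG j hj).comp continuous_fst.continuousOn fun p hp => hp.1)).mul ?_)
        exact ((hψ.smooth 0).continuous.continuousOn).mul (((contDiff_iterate_Dθ₁_sin2 i).continuous.comp continuous_snd).continuousOn)
      have hIK : IntegrableOn (fun p : ℝ × ℝ => α⁻¹ * (G j p.1 * ((φ p.1 p.2 * wordWeight α i p.1 p.2) * (Dθ₁^[i] sin2) p.2))) K volume :=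
        (hc.mono hKs).integrableOn_compact hKc
      refine hIK.of_forall_sdiff_eq_zero measurableSet_strip fun p hp => ?_
      have h0 : φ p.1 p.2 * wordWeight α i p.1 p.2 = 0 := by
        have := image_eq_zero_of_notMem_tsupport hp.2; exact this
      rw [h0]; ring
    rw [← MeasureTheory.integral_const_mul, ← integral_add]
    · refine setIntegral_congr_fun measurableSet_strip fun p hp => ?_
      rw [word_corrQ_strip D.limSmooth D.smoothG hij hp, D.keyG j hj p.1 hp.1]
      simp only [Function.iterate_succ, Function.iterate_zero, Function.comp_apply, id_eq]
      ring
    · have := h1.integrable.integrableOn (s := strip)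
      refine this.congr (ae_of_all _ fun p => ?_)
      simp only [uncurry_apply_pair]; ring
    · exact hcorr
  rw [eL]
  simp_rw [en]
  refine Tendsto.add (D.tendsto_word_sol hψ i j 2) (Tendsto.const_mul _ ?_)
  exact D.tendsto_corrector_pairing hψ hj

/-! ### The limit of the Theorem 2 bounds -/

/-- Smoothness of `corrQ(Ψ_n, L₁₂f_n)` on the strip. [folklore] -/
theorem corrQ_smooth (n : ℕ) : ContDiffOn ℝ ∞ (uncurry (corrQ α (thmTwoSol α (fs n) (Ψr n)) (L12 (fs n)))) strip :=
  contDiffOn_infty.2 fun m => contDiffOn_corrQ (D.solSmooth n) ((D.contDiff_L12 n).of_le (by exact_mod_cast le_top)).contDiffOn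

/-- Smoothness of `α²D_R^mΨ_n` on the strip. [folklore] -/
theorem smulDz_smooth (m n : ℕ) : ContDiffOn ℝ ∞ (uncurry ((α ^ 2) • (Dz^[m] (thmTwoSol α (fs n) (Ψr n))))) strip :=
  ((contDiffOn_iterate_Dz_strip_infty (D.solSmooth n) m).const_smul (α ^ 2)).congr fun _ _ => rfl

/-- `C⁴`-regularity of `α²D_R^mΨ` on the strip. [folklore] -/
theorem smulDz_lim (m : ℕ) : ContDiffOn ℝ 4 (uncurry ((α ^ 2) • (Dz^[m] fun R θ => Ψ (R, θ)))) strip :=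
  (((contDiffOn_iterate_Dz_strip_infty D.limSmooth m).const_smul (α ^ 2)).of_le
    (WithTop.coe_le_coe.2 le_top : (4 : WithTop ℕ∞) ≤ ((⊤ : ℕ∞) : WithTop ℕ∞))).congr fun _ _ => rfl

/-- **Convergence of the three `𝓗⁴` functionals.** [folklore] -/
theorem tendsto_functionals :
    Tendsto (fun n => eHkNormSq α 4 (corrQ α (thmTwoSol α (fs n) (Ψr n)) (L12 (fs n))) +
        eHkNormSq α 4 ((α ^ 2) • (Dz^[2] (thmTwoSol α (fs n) (Ψr n)))) + eHkNormSq α 4 ((α ^ 2) • (Dz^[1] (thmTwoSol α (fs n) (Ψr n)))))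
      atTop (𝓝 (eHkNormSq α 4 (corrQ α (fun R θ => Ψ (R, θ)) (G 0)) + eHkNormSq α 4 ((α ^ 2) • (Dz^[2] fun R θ => Ψ (R, θ))) +
        eHkNormSq α 4 ((α ^ 2) • (Dz^[1] fun R θ => Ψ (R, θ))))) := by
  have hC := thmTwoC_ne_top
  have hfin : ∀ n, thmTwoC * eHkNormSq α 4 (fs n) < ⊤ := fun n => ENNReal.mul_lt_top hC.lt_top (D.approx.test n).eHkNormSq_lt_top
  have hsum := fun n => D.bound n
  have hsub := fun N n m (hn : N ≤ n) (hm : N ≤ m) => (D.sub_bound n m).trans (mul_le_mul_right (D.fast_sub hn hm) _)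
  refine Tendsto.add (Tendsto.add ?_ ?_) ?_
  · refine tendsto_eHkNormSq_of_words D.corrQ_smooth (contDiffOn_corrQ D.limSmooth D.smoothG) hC
      (fun N n m hn hm => le_trans (le_add_right (le_add_right le_rfl)) (hsub N n m hn hm))
      (fun n => lt_of_le_of_lt (le_add_right (le_add_right le_rfl)) ((hsum n).trans_lt (hfin n))) fun i j hij φ hφ => D.htest_corrQ hij hφ
  · refine tendsto_eHkNormSq_of_words (D.smulDz_smooth 2) (D.smulDz_lim 2) hC
      (fun N n m hn hm => le_trans (le_add_right (le_add_left le_rfl)) (hsub N n m hn hm))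
      (fun n => lt_of_le_of_lt (le_add_right (le_add_left le_rfl)) ((hsum n).trans_lt (hfin n))) fun i j hij φ hφ => D.htest_smul_Dz 2 hij hφ
  · refine tendsto_eHkNormSq_of_words (D.smulDz_smooth 1) (D.smulDz_lim 1) hC
      (fun N n m hn hm => le_trans (le_add_left le_rfl) (hsub N n m hn hm))
      (fun n => lt_of_le_of_lt (le_add_left le_rfl) ((hsum n).trans_lt (hfin n))) fun i j hij φ hφ => D.htest_smul_Dz 1 hij hφ

/-- **Theorem 2 at `𝓗⁴` for the limit**:
`|∂_θθΨ + α⁻¹Λ ⊗ sin 2θ|²_{𝓗⁴} + |α²D_R²Ψ|²_{𝓗⁴} + |α²D_RΨ|²_{𝓗⁴} ≤ C|F|²_{𝓗⁴}`. [cite: Elgindi2021, §7.5 Theorem 2 with Remark 8.3 (pp. 24, 27 of arXiv:1904.04795)] -/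
theorem theoremTwo_limit :
    eHkNormSq α 4 (corrQ α (fun R θ => Ψ (R, θ)) (G 0)) + eHkNormSq α 4 ((α ^ 2) • (Dz^[2] fun R θ => Ψ (R, θ))) +
      eHkNormSq α 4 ((α ^ 2) • Dz fun R θ => Ψ (R, θ)) ≤ thmTwoC * eHkNormSq α 4 F := by
  have hlim := D.tendsto_functionals
  have hR : Tendsto (fun n => thmTwoC * eHkNormSq α 4 (fs n)) atTop (𝓝 (thmTwoC * eHkNormSq α 4 F)) :=
    ENNReal.Tendsto.const_mul D.approx.tendsto_eHkNormSq (Or.inr thmTwoC_ne_top)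
  have hle : ∀ n, eHkNormSq α 4 (corrQ α (thmTwoSol α (fs n) (Ψr n)) (L12 (fs n))) +
      eHkNormSq α 4 ((α ^ 2) • (Dz^[2] (thmTwoSol α (fs n) (Ψr n)))) + eHkNormSq α 4 ((α ^ 2) • (Dz^[1] (thmTwoSol α (fs n) (Ψr n)))) ≤
      thmTwoC * eHkNormSq α 4 (fs n) := fun n => D.bound n
  exact le_of_tendsto_of_tendsto' hlim hR hle

end ThmTwoLimit

/-! ### Theorem 2 in the closure class -/

/-- **Elgindi's Theorem 2 at `𝓗⁴` for data in the `𝓗⁴`-closure of the test functions**: for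
`0 < α ≤ 1/4` and `F` smooth on the open strip with an `𝓗⁴`-approximating sequence of test functions
`f_n → F`, there are a smooth solution `Ψ` of `L_αΨ = F` on the strip and a radial function
`Λ ∈ C⁴(0,∞)` — the uniform limit of the corrector data `L₁₂(f_{n_k})` along a subsequence — with
`|∂_θθΨ + α⁻¹Λ ⊗ sin 2θ|²_{𝓗⁴} + |α²D_R²Ψ|²_{𝓗⁴} + |α²D_RΨ|²_{𝓗⁴} ≤ C·|F|²_{𝓗⁴}`,
where `∂_θθΨ + α⁻¹Λ sin 2θ = ∂_θθ(Ψ − (4α)⁻¹Λ sin 2θ)` and `C = thmTwoC` is the constant of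
Theorem 2 for test data. [cite: Elgindi2021, §7.5 Theorem 2 with Remark 8.3 (pp. 24, 27 of arXiv:1904.04795)] -/
theorem theoremTwo_closure {α : ℝ} (hα : 0 < α) (hα4 : α ≤ 1 / 4) {F : ℝ → ℝ → ℝ} {fs : ℕ → ℝ → ℝ → ℝ} (hA : HkApprox α F fs) :
    ∃ (Ψ : ℝ × ℝ → ℝ) (Λ : ℝ → ℝ) (ns : ℕ → ℕ), StrictMono ns ∧ ContDiffOn ℝ ∞ Ψ strip ∧
      (∀ p ∈ strip, ellipticOp α (fun R θ => Ψ (R, θ)) p.1 p.2 = F p.1 p.2) ∧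
      ContDiffOn ℝ 4 Λ (Ioi 0) ∧ TendstoUniformly (fun n => L12 (fs (ns n))) Λ atTop ∧
      eHkNormSq α 4 (corrQ α (fun R θ => Ψ (R, θ)) Λ) + eHkNormSq α 4 ((α ^ 2) • (Dz^[2] fun R θ => Ψ (R, θ))) +
        eHkNormSq α 4 ((α ^ 2) • Dz fun R θ => Ψ (R, θ)) ≤ thmTwoC * eHkNormSq α 4 F := by
  have hN : ∀ n, NiceDatum (fs n) := fun n => (hA.test n).niceDatum
  choose U Ψr hS using fun n => exists_solData hα hα4 (hN n).contDiff_Fhat (hN n).hasCompactSupport_Fhat.1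
    (hN n).hasCompactSupport_Fhat.2 (fun m hm _ => (hN n).Fhat_orth hm)
  obtain ⟨ns, hns, hfast⟩ := hA.exists_fast
  obtain ⟨Ψ, G, D⟩ := exists_thmTwoLimit (hA.subseq hns) (fun n => hS (ns n)) hfast
  exact ⟨Ψ, G 0, ns, hns, D.smooth, D.eqn, D.smoothG, D.unifG, D.theoremTwo_limit⟩

/-- **Theorem 2 at `𝓗⁴` for strip-smooth data of finite `𝓗⁴` functional and finite `γ`-words**
(such data lie in the closure class by the logarithmic cut-offs, `hkApprox_cutFun`). [cite: Elgindi2021, §7.5 Theorem 2 with Remark 8.3 (pp. 24, 27 of arXiv:1904.04795)] -/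
theorem theoremTwo_of_finite {α : ℝ} (hα : 0 < α) (hα4 : α ≤ 1 / 4) {F : ℝ → ℝ → ℝ}
    (hF : ContDiffOn ℝ ∞ (uncurry F) strip) (hE : eHkNormSq α 4 F < ⊤) (hH : gammaWords α F < ⊤) :
    ∃ (Ψ : ℝ × ℝ → ℝ) (Λ : ℝ → ℝ) (ns : ℕ → ℕ), StrictMono ns ∧ ContDiffOn ℝ ∞ Ψ strip ∧
      (∀ p ∈ strip, ellipticOp α (fun R θ => Ψ (R, θ)) p.1 p.2 = F p.1 p.2) ∧
      ContDiffOn ℝ 4 Λ (Ioi 0) ∧ TendstoUniformly (fun n => L12 (cutFun ((ns n) + 1 : ℝ) F)) Λ atTop ∧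
      eHkNormSq α 4 (corrQ α (fun R θ => Ψ (R, θ)) Λ) + eHkNormSq α 4 ((α ^ 2) • (Dz^[2] fun R θ => Ψ (R, θ))) +
        eHkNormSq α 4 ((α ^ 2) • Dz fun R θ => Ψ (R, θ)) ≤ thmTwoC * eHkNormSq α 4 F := by
  obtain ⟨Ψ, Λ, ns, hns, h1, h2, h3, h4, h5⟩ := theoremTwo_closure hα hα4 (hkApprox_cutFun α hF hE hH)
  refine ⟨Ψ, Λ, ns, hns, h1, h2, h3, ?_, h5⟩
  have e : (fun n => L12 (cutFun ((ns n) + 1 : ℝ) F)) = fun n => L12 ((fun k : ℕ => cutFun (k + 1 : ℝ) F) (ns n)) := by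
    funext n; simp
  rw [e]; exact h4

/-! ### Identification of the corrector limit with `L₁₂(F)` -/

namespace ThmTwoLimit

variable {α : ℝ} {F : ℝ → ℝ → ℝ} {fs : ℕ → ℝ → ℝ → ℝ} {U : ℕ → ℕ → E4} {Ψr : ℕ → ℝ × ℝ → ℝ}
  {Ψ : ℝ × ℝ → ℝ} {G : ℕ → ℝ → ℝ} (D : ThmTwoLimit α F fs U Ψr Ψ G)
include D

/-- **The corrector limit is `L₁₂(F)`** on `[0, ∞)`. [cite: Elgindi2021, §7.5 (p. 24 of arXiv:1904.04795)] -/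
theorem G0_eq_L12 {z : ℝ} (hz : 0 ≤ z) : G 0 z = L12 F z :=
  tendsto_nhds_unique (D.unifG.tendsto_at z) (D.approx.tendsto_L12 hz)

/-- `L₁₂(F) ∈ C⁴(0,∞)` for closure data. [cite: Elgindi2021, §7.5 (p. 24 of arXiv:1904.04795)] -/
theorem contDiffOn_L12 : ContDiffOn ℝ 4 (L12 F) (Ioi 0) :=
  D.smoothG.congr fun _ hz => (D.G0_eq_L12 (le_of_lt hz)).symm

/-- **Theorem 2 at `𝓗⁴` for the limit, with the corrector `L₁₂(F)`.** [cite: Elgindi2021, §7.5 Theorem 2 with Remark 8.3 (pp. 24, 27 of arXiv:1904.04795)] -/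
theorem theoremTwo_limit_L12 :
    eHkNormSq α 4 (corrQ α (fun R θ => Ψ (R, θ)) (L12 F)) + eHkNormSq α 4 ((α ^ 2) • (Dz^[2] fun R θ => Ψ (R, θ))) +
      eHkNormSq α 4 ((α ^ 2) • Dz fun R θ => Ψ (R, θ)) ≤ thmTwoC * eHkNormSq α 4 F := by
  have e : eHkNormSq α 4 (corrQ α (fun R θ => Ψ (R, θ)) (L12 F)) = eHkNormSq α 4 (corrQ α (fun R θ => Ψ (R, θ)) (G 0)) :=
    eHkNormSq_congr_strip α 4 fun p hp => by
      simp only [corrQ, Pi.add_apply, Pi.smul_apply, smul_eq_mul, tensor_apply, D.G0_eq_L12 (le_of_lt hp.1)]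
  rw [e]
  exact D.theoremTwo_limit

end ThmTwoLimit

/-- **Elgindi's Theorem 2 at `𝓗⁴` in the closure class, corrector `L₁₂(F)`**: for `0 < α ≤ 1/4` and
`F` in the `𝓗⁴`-closure of the test functions there is a smooth solution `Ψ` of `L_αΨ = F` on the
strip with `L₁₂(F) ∈ C⁴(0,∞)` and
`|∂_θθΨ + α⁻¹L₁₂(F) ⊗ sin 2θ|²_{𝓗⁴} + |α²D_R²Ψ|²_{𝓗⁴} + |α²D_RΨ|²_{𝓗⁴} ≤ C·|F|²_{𝓗⁴}`
(`∂_θθΨ + α⁻¹L₁₂(F) sin 2θ = ∂_θθ(Ψ − (4α)⁻¹L₁₂(F) sin 2θ)` on the strip). [cite: Elgindi2021, §7.5 Theorem 2 with Remark 8.3 (pp. 24, 27 of arXiv:1904.04795)] -/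
theorem theoremTwo_closure_L12 {α : ℝ} (hα : 0 < α) (hα4 : α ≤ 1 / 4) {F : ℝ → ℝ → ℝ} {fs : ℕ → ℝ → ℝ → ℝ} (hA : HkApprox α F fs) :
    ∃ Ψ : ℝ × ℝ → ℝ, ContDiffOn ℝ ∞ Ψ strip ∧ (∀ p ∈ strip, ellipticOp α (fun R θ => Ψ (R, θ)) p.1 p.2 = F p.1 p.2) ∧
      ContDiffOn ℝ 4 (L12 F) (Ioi 0) ∧
      eHkNormSq α 4 (corrQ α (fun R θ => Ψ (R, θ)) (L12 F)) + eHkNormSq α 4 ((α ^ 2) • (Dz^[2] fun R θ => Ψ (R, θ))) +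
        eHkNormSq α 4 ((α ^ 2) • Dz fun R θ => Ψ (R, θ)) ≤ thmTwoC * eHkNormSq α 4 F := by
  have hN : ∀ n, NiceDatum (fs n) := fun n => (hA.test n).niceDatum
  choose U Ψr hS using fun n => exists_solData hα hα4 (hN n).contDiff_Fhat (hN n).hasCompactSupport_Fhat.1
    (hN n).hasCompactSupport_Fhat.2 (fun m hm _ => (hN n).Fhat_orth hm)
  obtain ⟨ns, hns, hfast⟩ := hA.exists_fast
  obtain ⟨Ψ, G, D⟩ := exists_thmTwoLimit (hA.subseq hns) (fun n => hS (ns n)) hfast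
  exact ⟨Ψ, D.smooth, D.eqn, D.contDiffOn_L12, D.theoremTwo_limit_L12⟩

/-- **Theorem 2 at `𝓗⁴` with corrector `L₁₂(F)` for strip-smooth data of finite `𝓗⁴` functional and
finite `γ`-words.** [cite: Elgindi2021, §7.5 Theorem 2 with Remark 8.3 (pp. 24, 27 of arXiv:1904.04795)] -/
theorem theoremTwo_of_finite_L12 {α : ℝ} (hα : 0 < α) (hα4 : α ≤ 1 / 4) {F : ℝ → ℝ → ℝ}
    (hF : ContDiffOn ℝ ∞ (uncurry F) strip) (hE : eHkNormSq α 4 F < ⊤) (hH : gammaWords α F < ⊤) :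
    ∃ Ψ : ℝ × ℝ → ℝ, ContDiffOn ℝ ∞ Ψ strip ∧ (∀ p ∈ strip, ellipticOp α (fun R θ => Ψ (R, θ)) p.1 p.2 = F p.1 p.2) ∧
      ContDiffOn ℝ 4 (L12 F) (Ioi 0) ∧
      eHkNormSq α 4 (corrQ α (fun R θ => Ψ (R, θ)) (L12 F)) + eHkNormSq α 4 ((α ^ 2) • (Dz^[2] fun R θ => Ψ (R, θ))) +
        eHkNormSq α 4 ((α ^ 2) • Dz fun R θ => Ψ (R, θ)) ≤ thmTwoC * eHkNormSq α 4 F :=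
  theoremTwo_closure_L12 hα hα4 (hkApprox_cutFun α hF hE hH)

end Elgindi

end Literature.Analysis.FluidPDE
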